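import Literature.Geometry.Kaehler.ComplexTorusCorrespondenceRingCornerDuality
import Literature.Geometry.Kaehler.ComplexTorusCorrespondenceRingHOneCorner
import Literature.Geometry.Kaehler.ComplexTorusHodgeCorrespondencesWeightOneAlgebraic
import HarnessLib

/-!
# Poincaré duality of motives in the ring of correspondences of a complex torus: the transpose is a `ℚ`-algebra
# anti-automorphism `C(X) ≃ₐ[ℚ] C(X)ᵒᵖ` carrying the endomorphism ring `End((h(X), p)) = p ∘ C(X) ∘ p` of every projector
# onto `End((h(X), ᵗp))ᵒᵖ`; `End(h^{2g-s}(X)) ≅ End(hˢ(X))ᵒᵖ`; the covariant realisation `End_ℚ(X) ≅ End(h^{2g-1}(X))`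

Layer `Literature/Geometry/Kaehler`, namespace `Literature.Geometry.Kaehler.ComplexTorus.CorrRing`; lane `lit-hodgefound`
(Track 2 foundations library), Layer A4, prover seat `lit-hodgefound-p08`, generation 22, FILE 1 of row g22-#2 (self-proposed
in the seat's lineage of Fulton's ring `C(X) = CorrRing`; FILE 2, deferred behind unbuilt oleans, transports the result to
`End_Hdg(H^{2g-s}(X, ℚ)) ≅ End_Hdg(Hˢ(X, ℚ))ᵒᵖ` through g21-#1's `hodgeCornerEquiv` and transfers primitivity with g22-#1's
`IsPrimitiveIdempotent`). CONSUMED BY NAME, nothing restated: Q1483 FILE 1 `ComplexTorusCorrespondenceAlgebraSemisimple`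
(`CorrRing`, `transpose`, `transpose_mul`, `transpose_transpose`, `transpose_one`, `transpose_add`, `ratCorr`, `hodgeCorr`,
`lefschetzCorr`, `transpose_mem_ratCorr / _hodgeCorr / _lefschetzCorr`), Q1483 FILE 2 `…KunnethIdempotents` (`kunnethIdem`,
`isIdempotentElem_kunnethIdem`, `transpose_kunnethIdem : ᵗπ_s = π_t` for `s + t = 2g`, `kunnethIdem_mem_…`), g17-#7
`…CornerDuality` (`transpose_kunnethIdem_mul`, `range_transpose_hOneRat`, `transpose_hOneRat_mul` — the corner images as
SETS and the covariant weight-one realisation as a FUNCTION; here both become RING isomorphisms), g18-#4 `…HOneCorner`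
(`hodgeKunnethIdem`, `isIdempotentElem_hodgeKunnethIdem`, `hOneRatCornerEquiv : End_ℚ(X)ᵒᵖ ≃+* End(h¹(X))`,
`coe_hOneRatCornerEquiv_apply`), g16-#2 `…HodgeCorrespondencesWeightOneAlgebraic` (`transpose_ratSmul`), Q1562
(`ratKunnethIdem`), Mathlib's corner rings `IsIdempotentElem.Corner`, `RingEquiv.unop`, `isSemisimpleRing_mulOpposite_iff`.

## Sources, verbatim

* H. Lange, *Abelian Varieties over the Complex Numbers* (Springer 2023), held text `book:lange1992-complex-abelian-varieties`,
  §6.2.2 p0304 L11–L13: "It induces an isomorphism `Ch(X₂ × X₁) → Ch(X₁ × X₂)`, `Z ↦ ᵗZ := s^*Z`"; §6.3.4 Prop. 6.3.10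
  p0318 L47: "**Proposition 6.3.10** `ᵗπ_i = π_{2g-i}` for `i = 0, …, 2g`".
* W. Fulton, *Intersection Theory* (2nd ed. 1998), held text `book:fultonnd-intersection-theory`, §16.1 Prop. 16.1.1 (b)
  (p0294): "`ᵗ(β ∘ α) = ᵗα ∘ ᵗβ`"; Example 16.1.15 (p0302): "`Hⁿ(X × X) ≅ ⊕ᵢ Hom(HⁱX, HⁱX)`".
* B. Kahn, *Zeta and L-Functions of Varieties and Motives* (CUP 2020), held text
  `book:kahn2020-zeta-l-functions-varieties-motives` p0135 L12–L16 (App. A Def. A.5 / Thm. A.6): "`C♮((C, p), (D, q)) =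
  {f ∈ C(C, D) | f = qfp}` […] the identity of `(C, p)` is `p`"; p0127 L30–L40 (§6.11 Thm. 6.37): "`h¹(A) = (h(A), p¹)` […]
  It induces a fully faithful functor `h¹ : Ab⁰(k)^{op} → M_rat(k, ℚ)`"; §6.1 (the duality `M ↦ M^∨` of `Corr(k, F)`:
  `Hom(h(X), h(Y)) = CH^{dim X}(X × Y)`, the transpose of a correspondence is the dual morphism), §6.9 Def. 6.28.
* P. Deligne, J. S. Milne, *Tannakian categories* (LNM 900, 1982), §6 Prop. 6.21 (a) (`h₁` covariant on isogeny classes).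
* T. Y. Lam, *A First Course in Noncommutative Rings*, 2nd ed. (2001), §21 (21.4)–(21.7) (corner rings `eRe`), §1 (the
  opposite ring `Rᵒᵖ`; an anti-isomorphism `R → S` "is" an isomorphism `R ≅ Sᵒᵖ`).

## What is proved (torus level; `X = E/Φ(ℤ^ι)` of dimension `g`, `e` a positively oriented enumeration of the lattice basis,
## `e'` one of the product lattice; `C(X) = CorrRing Φ e he e'`; `π_s = kunnethIdem s`; `End((h(X), p)) = p ∘ C(X) ∘ p` is Mathlib's
## corner `IsIdempotentElem.Corner`, unit `p`)

* §0 (pure algebra, any ring `R`) `cornerOpEquiv`: a ring anti-automorphism `τ : R ≃+* Rᵒᵖ` with `τ(p) = q` restricts to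
  **`pRp ≃+* (qRq)ᵒᵖ`** for idempotents `p`, `q`; and its consequences (`IsSemisimpleRing`, commutativity and
  "division ring" are shared by `pRp` and `qRq`).
* §1 **THE TRANSPOSE AS A `ℚ`-ALGEBRA ANTI-AUTOMORPHISM `transposeOp : C(X) ≃ₐ[ℚ] C(X)ᵒᵖ`** (`ᵗ(u ∘ v) = ᵗv ∘ ᵗu`, `ᵗᵗ = id`,
  `ᵗ[Δ] = [Δ]`, `ᵗ(q • u) = q • ᵗu`), and its restrictions `transposeOpSub A : A ≃ₐ[ℚ] Aᵒᵖ` to every transpose-stable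
  `ℚ`-subalgebra (`ratCorr`, `hodgeCorr`, `lefschetzCorr hη`): each of the three algebras is ANTI-ISOMORPHIC TO ITSELF.
* §2 **DUALITY OF MOTIVES, ENDOMORPHISM FORM: `End((h(X), p)) ≃+* End((h(X), ᵗp))ᵒᵖ`** for every projector `p` of `C(X)`
  (`ᵗp` is a projector; `cornerTransposeEquiv`) and of a transpose-stable subalgebra (`cornerTransposeEquivSub`) — the
  transpose realises the dual motive `(h(X), p)^∨ ≅ (h(X), ᵗp)(g)`.
* §3 **`End(h^{2g-s}(X)) ≃+* End(hˢ(X))ᵒᵖ`** (`ᵗπ_s = π_{2g-s}`): for the whole ring (`kunnethCornerDualEquiv`), for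
  `H^{2g}(X × X, ℚ)` (`ratKunnethCornerDualEquiv`), for `B^g(X × X)` (`hodgeKunnethCornerDualEquiv`) and for `D^g(X × X)`
  (`lefschetzKunnethCornerDualEquiv`); hence the corners at `s` and `2g-s` are simultaneously semisimple / commutative /
  division rings (`isSemisimpleRing_corner_hodgeKunnethIdem_iff_of_add_eq`, `…_comm_iff_…`, `…_forall_isUnit_iff_…`); the
  middle corner `End(hᵍ(X))` is anti-isomorphic to itself.
* §4 **THE COVARIANT REALISATION `hTopRatCornerEquiv : End_ℚ(X) ≃+* End(h^{2g-1}(X)) = π_{2g-1} ∘ B^g(X × X) ∘ π_{2g-1}`,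
  `B ↦ ᵗ(h¹(B))`** — a ring ISOMORPHISM (not anti): g18-#4's `hOneRatCornerEquiv : End_ℚ(X)ᵒᵖ ≅ End(h¹(X))` composed with
  §3 for `s = 1` (`h₁ = (h¹)^∨`: Deligne–Milne's covariant `h₁`, Kahn's duality), `coe_hTopRatCornerEquiv_apply`.

Definitions with bodies (`cornerOpEquiv`, `transposeOp`, `transposeOpSub`, `cornerTransposeEquiv(Sub)`, the four Künneth
duality equivalences, `hTopRatCornerEquiv`) and theorems; NO named fact, net Literature debt 0. NOT here: the tensor
structure / Tate twist bookkeeping of the rigid category `M_hom` (only endomorphism rings are compared), the integral ring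
`H^{2g}(X × X, ℤ)` (g18-#4's `intHodgeCorr`; the same proofs apply), `End_Hdg(H^{2g-s}(X, ℚ)) ≅ End_Hdg(Hˢ(X, ℚ))ᵒᵖ` (FILE 2).

## References

* [Lange2023AbelianVarietiesComplex] H. Lange, *Abelian Varieties over the Complex Numbers*, Grundlehren Text Editions,
  Springer (2023), §6.2.2 p. 304, §6.3.4 Prop. 6.3.10 p. 318.
* [Fulton1998] W. Fulton, *Intersection Theory*, 2nd ed., Springer (1998), §16.1 Prop. 16.1.1 (b), Example 16.1.15.
* [Kahn2020] B. Kahn, *Zeta and L-Functions of Varieties and Motives*, LMS LN 462, CUP (2020), §6.1, §6.9 Def. 6.28, §6.11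
  Thm. 6.37, App. A Def. A.5.
* [DeligneMilne1982Tannakian] P. Deligne, J. S. Milne, *Tannakian Categories*, LNM 900 (1982), §6 Prop. 6.21 (a).
* [Lam2001FirstCourse] T. Y. Lam, *A First Course in Noncommutative Rings*, 2nd ed., GTM 131 (2001), §1, §21 (21.4)–(21.7).
-/

noncomputable section

-- Nested instance problems on the carriers (as in the sibling files); ring isomorphisms into corner types need the
-- larger instance budget of g21-#1's file.
set_option maxSynthPendingDepth 3
set_option synthInstance.maxHeartbeats 200000

open Function Module MulOpposite

namespace Literature.Geometry.Kaehler

namespace ComplexTorus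

universe u

namespace CorrRing

/-! ## §0 Pure algebra: an anti-automorphism exchanging two idempotents exchanges their corners (up to `ᵒᵖ`) -/

section CornerOp

variable {R : Type*} [Ring R]

/-- Membership in a corner is detected by `p x p = x`. [cite: Lam2001FirstCourse, §21 (21.4)] -/
private theorem mem_corner_of_eq {p x : R} (h : p * x * p = x) : x ∈ Subsemigroup.corner p :=
  ⟨x, h⟩

/-- For `x ∈ pRp`: `p x p = x`. [cite: Lam2001FirstCourse, §21 (21.4)] -/
private theorem eq_of_mem_corner {p : R} (hp : IsIdempotentElem p) (x : hp.Corner) : p * x.1 * p = x.1 := by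
  obtain ⟨h₁, h₂⟩ := (Subsemigroup.mem_corner_iff hp).1 x.2
  rw [h₁, h₂]

/-- **A ring anti-automorphism `τ : R ≃+* Rᵒᵖ` with `τ(p) = q` (`p`, `q` idempotents) restricts to a ring isomorphism
`pRp ≃+* (qRq)ᵒᵖ` of corners**, `x ↦ τ(x)` (`τ(p x p) = q τ(x) q` read in `Rᵒᵖ`). [cite: Lam2001FirstCourse, §21 (21.4)–(21.7) and §1 (opposite ring)]
[cite: Fulton1998, §16.1 Prop. 16.1.1 (b)] -/
def cornerOpEquiv (τ : R ≃+* Rᵐᵒᵖ) {p q : R} (hp : IsIdempotentElem p) (hq : IsIdempotentElem q) (hpq : τ p = op q) :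
    hp.Corner ≃+* (hq.Corner)ᵐᵒᵖ where
  toFun x := op ⟨(τ x.1).unop, mem_corner_of_eq (by
    have h := congr_arg unop (congr_arg τ (eq_of_mem_corner hp x))
    rw [map_mul, map_mul, hpq, unop_mul, unop_mul, MulOpposite.unop_op, ← mul_assoc] at h
    exact h)⟩
  invFun y := ⟨τ.symm (op y.unop.1), mem_corner_of_eq (by
    have hqp : τ.symm (op q) = p := by rw [← hpq, RingEquiv.symm_apply_apply]
    have h := congr_arg (fun z ↦ τ.symm (op z)) (eq_of_mem_corner hq y.unop)
    simp only [op_mul, map_mul, hqp] at h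
    rw [← mul_assoc] at h
    exact h)⟩
  left_inv x := Subtype.ext (by
    change τ.symm (op (unop (τ x.1))) = x.1
    rw [MulOpposite.op_unop, RingEquiv.symm_apply_apply])
  right_inv y := by
    induction y with
    | h y =>
      refine congr_arg op (Subtype.ext ?_)
      change unop (τ (τ.symm (op y.1))) = y.1
      rw [RingEquiv.apply_symm_apply, MulOpposite.unop_op]
  map_mul' x y := by
    rw [← op_mul]
    congr 1
    apply Subtype.ext
    change (τ (x.1 * y.1)).unop = (τ y.1).unop * (τ x.1).unop
    rw [map_mul, unop_mul]
  map_add' x y := by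
    rw [← op_add]
    congr 1
    apply Subtype.ext
    change (τ (x.1 + y.1)).unop = (τ x.1).unop + (τ y.1).unop
    rw [map_add, unop_add]

/-- Unfolding of `cornerOpEquiv`: the underlying element of `cornerOpEquiv τ x` is `τ(x)`. [cite: Lam2001FirstCourse, §21 (21.4)] -/
@[simp] theorem coe_unop_cornerOpEquiv_apply (τ : R ≃+* Rᵐᵒᵖ) {p q : R} (hp : IsIdempotentElem p)
    (hq : IsIdempotentElem q) (hpq : τ p = op q) (x : hp.Corner) :
    ((cornerOpEquiv τ hp hq hpq x).unop).1 = (τ x.1).unop := rfl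

/-- Unfolding of the inverse: the underlying element of `(cornerOpEquiv τ)⁻¹ y` is `τ⁻¹(y)`. [cite: Lam2001FirstCourse, §21 (21.4)] -/
@[simp] theorem coe_cornerOpEquiv_symm_apply (τ : R ≃+* Rᵐᵒᵖ) {p q : R} (hp : IsIdempotentElem p)
    (hq : IsIdempotentElem q) (hpq : τ p = op q) (y : (hq.Corner)ᵐᵒᵖ) :
    ((cornerOpEquiv τ hp hq hpq).symm y).1 = τ.symm (op y.unop.1) := rfl

/-- Corners exchanged by an anti-automorphism are simultaneously semisimple. [cite: Lam2001FirstCourse, §21 Cor. (21.13) and §1] -/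
theorem isSemisimpleRing_corner_iff_of_ringEquiv_op {p q : R} (hp : IsIdempotentElem p) (hq : IsIdempotentElem q)
    (f : hp.Corner ≃+* (hq.Corner)ᵐᵒᵖ) : IsSemisimpleRing hp.Corner ↔ IsSemisimpleRing hq.Corner := by
  rw [f.isSemisimpleRing_iff, isSemisimpleRing_mulOpposite_iff]

/-- Corners exchanged by an anti-automorphism are simultaneously commutative. [cite: Lam2001FirstCourse, §1 (opposite ring)] -/
theorem corner_comm_iff_of_ringEquiv_op {p q : R} (hp : IsIdempotentElem p) (hq : IsIdempotentElem q)
    (f : hp.Corner ≃+* (hq.Corner)ᵐᵒᵖ) :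
    (∀ x y : hp.Corner, x * y = y * x) ↔ ∀ x y : hq.Corner, x * y = y * x := by
  constructor
  · intro h x y
    have := h (f.symm (op y)) (f.symm (op x))
    rw [← map_mul, ← map_mul, f.symm.injective.eq_iff, ← op_mul, ← op_mul, op_inj] at this
    exact this
  · intro h x y
    have := h (f y).unop (f x).unop
    rw [← unop_mul, ← unop_mul, unop_inj, ← map_mul, ← map_mul, f.injective.eq_iff] at this
    exact this

/-- Corners exchanged by an anti-automorphism are simultaneously division rings (every non-zero element a unit).
[cite: Lam2001FirstCourse, §21 Prop. (21.16) and §1] -/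
theorem corner_forall_isUnit_iff_of_ringEquiv_op {p q : R} (hp : IsIdempotentElem p) (hq : IsIdempotentElem q)
    (f : hp.Corner ≃+* (hq.Corner)ᵐᵒᵖ) :
    (∀ x : hp.Corner, x ≠ 0 → IsUnit x) ↔ ∀ x : hq.Corner, x ≠ 0 → IsUnit x := by
  constructor
  · intro h x hx
    have hx' : f.symm (op x) ≠ 0 := fun h0 ↦ hx (by
      rw [← op_eq_zero_iff, ← f.symm.injective.eq_iff, h0, map_zero])
    have hu := (h _ hx').map f
    rw [f.apply_symm_apply] at hu
    exact hu.unop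
  · intro h x hx
    have hx' : (f x).unop ≠ 0 := fun h0 ↦ hx (by
      rw [← f.injective.eq_iff, map_zero, ← op_unop (f x), h0, op_zero])
    have hu := (h _ hx').op
    rw [op_unop] at hu
    simpa only [RingEquiv.symm_apply_apply] using hu.map f.symm

end CornerOp

/-! ## §1 The transpose as a `ℚ`-algebra anti-automorphism of `C(X)` and of its transpose-stable subalgebras -/

section Transpose

variable {ι : Type*} [Fintype ι] [DecidableEq ι] {E : Type u} [NormedAddCommGroup E] [NormedSpace ℂ E]
  (Φ : (ι → ℝ) ≃L[ℝ] E) {g : ℕ} (e : Fin (g + g) ≃ ι) (he : orientationSign Φ e = 1)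
  (e' : Fin ((g + g) + (g + g)) ≃ ι ⊕ ι)

/-- **`transposeOp : C(X) ≃ₐ[ℚ] C(X)ᵒᵖ`, `u ↦ ᵗu`** — the transpose is a `ℚ`-algebra ANTI-automorphism of Fulton's ring of
correspondences (`ᵗ(u ∘ v) = ᵗv ∘ ᵗu`, `ᵗᵗu = u`, `ᵗ[Δ] = [Δ]`, `ᵗ(u + v) = ᵗu + ᵗv`, `ᵗ(q • u) = q • ᵗu`).
[cite: Fulton1998, §16.1 Prop. 16.1.1 (b)] [cite: Lange2023AbelianVarietiesComplex, §6.2.2 p. 304] -/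
def transposeOp : CorrRing Φ e he e' ≃ₐ[ℚ] (CorrRing Φ e he e')ᵐᵒᵖ :=
  AlgEquiv.ofRingEquiv (f :=
    { toFun := fun u ↦ op (transpose Φ e he e' u)
      invFun := fun v ↦ transpose Φ e he e' v.unop
      left_inv := fun u ↦ by simp only [MulOpposite.unop_op, transpose_transpose]
      right_inv := fun v ↦ by
        induction v with
        | h v => simp only [MulOpposite.unop_op, transpose_transpose]
      map_mul' := fun u v ↦ by rw [transpose_mul, op_mul]
      map_add' := fun u v ↦ by rw [transpose_add, op_add] })
    fun q ↦ by
      change op (transpose Φ e he e' (algebraMap ℚ (CorrRing Φ e he e') q)) = algebraMap ℚ (CorrRing Φ e he e')ᵐᵒᵖ q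
      rw [Algebra.algebraMap_eq_smul_one, transpose_ratSmul, transpose_one, MulOpposite.algebraMap_apply,
        Algebra.algebraMap_eq_smul_one, op_smul, op_one]

/-- Unfolding: `transposeOp u = op ᵗu`. [cite: Lange2023AbelianVarietiesComplex, §6.2.2 p. 304] -/
@[simp] theorem transposeOp_apply (u : CorrRing Φ e he e') : transposeOp Φ e he e' u = op (transpose Φ e he e' u) := rfl

/-- Unfolding: `transposeOp⁻¹ v = ᵗ(unop v)`. [cite: Lange2023AbelianVarietiesComplex, §6.2.2 p. 304] -/
@[simp] theorem transposeOp_symm_apply (v : (CorrRing Φ e he e')ᵐᵒᵖ) :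
    (transposeOp Φ e he e').symm v = transpose Φ e he e' v.unop := rfl

/-- `ᵗ0 = 0`, `ᵗ(-u) = -ᵗu`, `ᵗ(u - v) = ᵗu - ᵗv`: the transpose is additive (read off `transposeOp`).
[cite: Lange2023AbelianVarietiesComplex, §6.2.2 p. 304] -/
theorem transpose_sub (u v : CorrRing Φ e he e') :
    transpose Φ e he e' (u - v) = transpose Φ e he e' u - transpose Φ e he e' v := by
  have h := map_sub (transposeOp Φ e he e') u v
  rw [transposeOp_apply, transposeOp_apply, transposeOp_apply, ← op_sub] at h
  exact op_injective h

/-- `ᵗp` is a projector when `p` is. [cite: Lange2023AbelianVarietiesComplex, §6.3.4 Prop. 6.3.10] [cite: Fulton1998, §16.1 Prop. 16.1.1 (b)] -/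
theorem isIdempotentElem_transpose {p : CorrRing Φ e he e'} (hp : IsIdempotentElem p) :
    IsIdempotentElem (transpose Φ e he e' p) := by
  change transpose Φ e he e' p * transpose Φ e he e' p = transpose Φ e he e' p
  rw [← transpose_mul, hp.eq]

/-- **The transpose restricted to a transpose-stable `ℚ`-subalgebra `A` of `C(X)` is a `ℚ`-algebra anti-automorphism
`A ≃ₐ[ℚ] Aᵒᵖ`** (used for `A = H^{2g}(X × X, ℚ)`, `B^g(X × X)`, `D^g(X × X)`). [cite: Fulton1998, §16.1 Prop. 16.1.1 (b)]
[cite: Lange2023AbelianVarietiesComplex, §6.2.2 p. 304] -/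
def transposeOpSub (A : Subalgebra ℚ (CorrRing Φ e he e')) (hA : ∀ a ∈ A, transpose Φ e he e' a ∈ A) : A ≃ₐ[ℚ] Aᵐᵒᵖ :=
  AlgEquiv.ofRingEquiv (f :=
    { toFun := fun u ↦ op ⟨transpose Φ e he e' u.1, hA _ u.2⟩
      invFun := fun v ↦ ⟨transpose Φ e he e' v.unop.1, hA _ v.unop.2⟩
      left_inv := fun u ↦ Subtype.ext (by
        change transpose Φ e he e' (transpose Φ e he e' u.1) = u.1
        rw [transpose_transpose])
      right_inv := fun v ↦ by
        induction v with
        | h v =>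
          refine congr_arg op (Subtype.ext ?_)
          change transpose Φ e he e' (transpose Φ e he e' v.1) = v.1
          rw [transpose_transpose]
      map_mul' := fun u v ↦ by
        rw [← op_mul]
        exact congr_arg op (Subtype.ext (transpose_mul Φ e he e' u.1 v.1))
      map_add' := fun u v ↦ by
        rw [← op_add]
        exact congr_arg op (Subtype.ext (transpose_add Φ e he e' u.1 v.1)) })
    fun q ↦ by
      change op (⟨transpose Φ e he e' (algebraMap ℚ A q).1, _⟩ : A) = algebraMap ℚ Aᵐᵒᵖ q
      rw [MulOpposite.algebraMap_apply]
      refine congr_arg op (Subtype.ext ?_)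
      change transpose Φ e he e' (algebraMap ℚ A q : CorrRing Φ e he e') = (algebraMap ℚ A q : CorrRing Φ e he e')
      rw [Subalgebra.coe_algebraMap, Algebra.algebraMap_eq_smul_one, transpose_ratSmul, transpose_one]

/-- Unfolding: the underlying correspondence of `transposeOpSub A u` is `ᵗu`. [cite: Lange2023AbelianVarietiesComplex, §6.2.2 p. 304] -/
@[simp] theorem coe_unop_transposeOpSub_apply (A : Subalgebra ℚ (CorrRing Φ e he e'))
    (hA : ∀ a ∈ A, transpose Φ e he e' a ∈ A) (u : A) :
    (((transposeOpSub Φ e he e' A hA u).unop : A) : CorrRing Φ e he e') = transpose Φ e he e' u := rfl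

/-- **`H^{2g}(X × X, ℚ)` is anti-isomorphic to itself**: `ratCorr ≃ₐ[ℚ] ratCorrᵒᵖ` by the transpose.
[cite: Fulton1998, §16.1 Prop. 16.1.1 (b) and Example 16.1.15] -/
def ratTransposeOp : ratCorr Φ e he e' ≃ₐ[ℚ] (ratCorr Φ e he e')ᵐᵒᵖ :=
  transposeOpSub Φ e he e' _ fun _ ha ↦ transpose_mem_ratCorr Φ e he e' ha

/-- **`B^g(X × X)` is anti-isomorphic to itself**: `hodgeCorr ≃ₐ[ℚ] hodgeCorrᵒᵖ` by the transpose (the transpose of a Hodge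
class is a Hodge class). [cite: Lange2023AbelianVarietiesComplex, §6.2.1 Lemma 6.2.7 and §6.2.2 p. 304] [cite: Fulton1998, §16.1 Prop. 16.1.1 (b)] -/
def hodgeTransposeOp : hodgeCorr Φ e he e' ≃ₐ[ℚ] (hodgeCorr Φ e he e')ᵐᵒᵖ :=
  transposeOpSub Φ e he e' _ fun _ ha ↦ transpose_mem_hodgeCorr Φ e he e' ha

/-- Unfolding of `hodgeTransposeOp`. [cite: Lange2023AbelianVarietiesComplex, §6.2.2 p. 304] -/
@[simp] theorem coe_unop_hodgeTransposeOp_apply (u : hodgeCorr Φ e he e') :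
    (((hodgeTransposeOp Φ e he e' u).unop : hodgeCorr Φ e he e') : CorrRing Φ e he e') = transpose Φ e he e' u := rfl

section Lefschetz

variable [FiniteDimensional ℂ E] {η : E [⋀^Fin 2]→L[ℝ] ℝ}

/-- **`D^g(X × X)` is anti-isomorphic to itself** (polarised torus): `lefschetzCorr hη ≃ₐ[ℚ] (lefschetzCorr hη)ᵒᵖ` by the
transpose. [cite: Milne1999LefschetzClasses, §5 Cor. 5.8] [cite: Fulton1998, §16.1 Prop. 16.1.1 (b)] -/
def lefschetzTransposeOp (hη : IsRiemannForm Φ η) : lefschetzCorr Φ e he e' hη ≃ₐ[ℚ] (lefschetzCorr Φ e he e' hη)ᵐᵒᵖ :=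
  transposeOpSub Φ e he e' _ fun _ ha ↦ transpose_mem_lefschetzCorr Φ e he e' hη ha

end Lefschetz

/-! ## §2 Duality of motives, endomorphism form: `End((h(X), p)) ≃+* End((h(X), ᵗp))ᵒᵖ` -/

/-- **`End((h(X), p)) = p ∘ C(X) ∘ p ≃+* (ᵗp ∘ C(X) ∘ ᵗp)ᵒᵖ = End((h(X), ᵗp))ᵒᵖ` for every projector `p` of `C(X)`** — the
transpose realises the duality `(h(X), p)^∨ = (h(X), ᵗp)(g)` on endomorphism rings (`x ↦ ᵗx`).
[cite: Kahn2020, §6.1 and App. A Def. A.5] [cite: Fulton1998, §16.1 Prop. 16.1.1 (b)] [cite: Lange2023AbelianVarietiesComplex, §6.2.2 p. 304] -/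
def cornerTransposeEquiv {p : CorrRing Φ e he e'} (hp : IsIdempotentElem p) :
    hp.Corner ≃+* ((isIdempotentElem_transpose Φ e he e' hp).Corner)ᵐᵒᵖ :=
  cornerOpEquiv (transposeOp Φ e he e').toRingEquiv hp _ rfl

/-- Unfolding: the underlying correspondence of `cornerTransposeEquiv x` is `ᵗx`. [cite: Lange2023AbelianVarietiesComplex, §6.2.2 p. 304] -/
@[simp] theorem coe_unop_cornerTransposeEquiv_apply {p : CorrRing Φ e he e'} (hp : IsIdempotentElem p) (x : hp.Corner) :
    ((cornerTransposeEquiv Φ e he e' hp x).unop).1 = transpose Φ e he e' x.1 := rfl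

/-- **The same inside a transpose-stable subalgebra `A`: `End_A((h(X), p)) ≃+* End_A((h(X), ᵗp))ᵒᵖ`** for a projector
`p ∈ A` and any projector `q ∈ A` with `ᵗp = q` (stated with `q` free so that `q = π_{2g-s}` can be chosen on the nose).
[cite: Kahn2020, §6.1 and App. A Def. A.5] [cite: Fulton1998, §16.1 Prop. 16.1.1 (b)] -/
def cornerTransposeEquivSub (A : Subalgebra ℚ (CorrRing Φ e he e')) (hA : ∀ a ∈ A, transpose Φ e he e' a ∈ A)
    {p q : A} (hp : IsIdempotentElem p) (hq : IsIdempotentElem q)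
    (hpq : transpose Φ e he e' (p : CorrRing Φ e he e') = q) : hp.Corner ≃+* (hq.Corner)ᵐᵒᵖ :=
  cornerOpEquiv (transposeOpSub Φ e he e' A hA).toRingEquiv hp hq (by
    change op (⟨transpose Φ e he e' p.1, _⟩ : A) = op q
    exact congr_arg op (Subtype.ext hpq))

/-- Unfolding: the underlying correspondence of `cornerTransposeEquivSub … x` is `ᵗx`. [cite: Lange2023AbelianVarietiesComplex, §6.2.2 p. 304] -/
@[simp] theorem coe_coe_unop_cornerTransposeEquivSub_apply (A : Subalgebra ℚ (CorrRing Φ e he e'))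
    (hA : ∀ a ∈ A, transpose Φ e he e' a ∈ A) {p q : A} (hp : IsIdempotentElem p) (hq : IsIdempotentElem q)
    (hpq : transpose Φ e he e' (p : CorrRing Φ e he e') = q) (x : hp.Corner) :
    ((((cornerTransposeEquivSub Φ e he e' A hA hp hq hpq x).unop).1 : A) : CorrRing Φ e he e') =
      transpose Φ e he e' (x.1 : CorrRing Φ e he e') := rfl

/-! ## §3 `End(h^{2g-s}(X)) ≃+* End(hˢ(X))ᵒᵖ`: the Künneth corners at `s` and `2g - s` -/

/-- **`π_s ∘ C(X) ∘ π_s ≃+* (π_t ∘ C(X) ∘ π_t)ᵒᵖ` for `s + t = 2g`** (`ᵗπ_s = π_t`, Prop. 6.3.10): in the whole ring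
`H^{2g}(X × X, ℂ) ≅ ⊕ᵢ Hom(HⁱX, HⁱX)` the corners `End(H^{2g-s})` and `End(Hˢ) ≅ End((H^{2g-s})^∨)` are anti-isomorphic.
[cite: Lange2023AbelianVarietiesComplex, §6.3.4 Prop. 6.3.10] [cite: Fulton1998, Example 16.1.15] -/
def kunnethCornerDualEquiv (s t : ℕ) (hst : s + t = g + g) :
    (isIdempotentElem_kunnethIdem Φ e he e' s).Corner ≃+* ((isIdempotentElem_kunnethIdem Φ e he e' t).Corner)ᵐᵒᵖ :=
  cornerOpEquiv (transposeOp Φ e he e').toRingEquiv _ _ (by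
    change op (transpose Φ e he e' (kunnethIdem Φ e he e' s)) = _
    rw [transpose_kunnethIdem Φ e he e' s t hst])

/-- `π_s` is idempotent in `H^{2g}(X × X, ℚ)` (Q1562's `ratKunnethIdem`). [cite: Lange2023AbelianVarietiesComplex, §6.3.4 Prop. 6.3.9 (a)] -/
theorem isIdempotentElem_ratKunnethIdem (s : ℕ) : IsIdempotentElem (ratKunnethIdem Φ e he e' s) :=
  Subtype.ext (isIdempotentElem_kunnethIdem Φ e he e' s).eq

/-- **`End_{H^{2g}(X×X,ℚ)}(h^{t}(X)) ≃+* End(hˢ(X))ᵒᵖ`, `s + t = 2g`, for the rational correspondences.**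
[cite: Lange2023AbelianVarietiesComplex, §6.3.4 Prop. 6.3.10] [cite: Kahn2020, §6.1 and §6.9 Def. 6.28] -/
def ratKunnethCornerDualEquiv (s t : ℕ) (hst : s + t = g + g) :
    (isIdempotentElem_ratKunnethIdem Φ e he e' s).Corner ≃+* ((isIdempotentElem_ratKunnethIdem Φ e he e' t).Corner)ᵐᵒᵖ :=
  cornerTransposeEquivSub Φ e he e' _ (fun _ ha ↦ transpose_mem_ratCorr Φ e he e' ha) _ _
    (by rw [coe_ratKunnethIdem, coe_ratKunnethIdem, transpose_kunnethIdem Φ e he e' s t hst])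

/-- **POINCARÉ DUALITY OF THE MOTIVES `hˢ(X)` AND `h^{2g-s}(X)` IN HODGE CORRESPONDENCES: `End(hᵗ(X)) = π_t ∘ B^g(X × X) ∘ π_t
≃+* (π_s ∘ B^g(X × X) ∘ π_s)ᵒᵖ = End(hˢ(X))ᵒᵖ` for `s + t = 2g`** (g18-#4's corners of `hodgeKunnethIdem`), `x ↦ ᵗx`.
[cite: Lange2023AbelianVarietiesComplex, §6.3.4 Prop. 6.3.10] [cite: Kahn2020, §6.1 and §6.9 Def. 6.28] [cite: Fulton1998, Example 16.1.15] -/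
def hodgeKunnethCornerDualEquiv (s t : ℕ) (hst : s + t = g + g) :
    (isIdempotentElem_hodgeKunnethIdem Φ e he e' s).Corner ≃+*
      ((isIdempotentElem_hodgeKunnethIdem Φ e he e' t).Corner)ᵐᵒᵖ :=
  cornerTransposeEquivSub Φ e he e' _ (fun _ ha ↦ transpose_mem_hodgeCorr Φ e he e' ha) _ _
    (by rw [coe_hodgeKunnethIdem, coe_hodgeKunnethIdem, transpose_kunnethIdem Φ e he e' s t hst])

/-- Unfolding: the underlying correspondence of `hodgeKunnethCornerDualEquiv s t hst x` is `ᵗx`.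
[cite: Lange2023AbelianVarietiesComplex, §6.3.4 Prop. 6.3.10] -/
@[simp] theorem coe_coe_unop_hodgeKunnethCornerDualEquiv_apply (s t : ℕ) (hst : s + t = g + g)
    (x : (isIdempotentElem_hodgeKunnethIdem Φ e he e' s).Corner) :
    ((((hodgeKunnethCornerDualEquiv Φ e he e' s t hst x).unop).1 : hodgeCorr Φ e he e') : CorrRing Φ e he e') =
      transpose Φ e he e' (x.1 : CorrRing Φ e he e') := rfl

/-- **`End(hᵗ(X))` and `End(hˢ(X))` (`s + t = 2g`, Hodge correspondences) are simultaneously semisimple.**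
[cite: Lange2023AbelianVarietiesComplex, §6.3.4 Prop. 6.3.10] [cite: Lam2001FirstCourse, §21 Cor. (21.13) and §1] -/
theorem isSemisimpleRing_corner_hodgeKunnethIdem_iff_of_add_eq (s t : ℕ) (hst : s + t = g + g) :
    IsSemisimpleRing (isIdempotentElem_hodgeKunnethIdem Φ e he e' s).Corner ↔
      IsSemisimpleRing (isIdempotentElem_hodgeKunnethIdem Φ e he e' t).Corner :=
  isSemisimpleRing_corner_iff_of_ringEquiv_op _ _ (hodgeKunnethCornerDualEquiv Φ e he e' s t hst)

/-- **`End(hᵗ(X))` is commutative iff `End(hˢ(X))` is** (`s + t = 2g`). [cite: Lange2023AbelianVarietiesComplex, §6.3.4 Prop. 6.3.10]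
[cite: Lam2001FirstCourse, §1 (opposite ring)] -/
theorem corner_hodgeKunnethIdem_comm_iff_of_add_eq (s t : ℕ) (hst : s + t = g + g) :
    (∀ x y : (isIdempotentElem_hodgeKunnethIdem Φ e he e' s).Corner, x * y = y * x) ↔
      ∀ x y : (isIdempotentElem_hodgeKunnethIdem Φ e he e' t).Corner, x * y = y * x :=
  corner_comm_iff_of_ringEquiv_op _ _ (hodgeKunnethCornerDualEquiv Φ e he e' s t hst)

/-- **`End(hᵗ(X))` is a division ring iff `End(hˢ(X))` is** (`s + t = 2g`; e.g. `s = 1`, `t = 2g - 1`: both iff `End_ℚ(X)`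
is a division algebra). [cite: Lange2023AbelianVarietiesComplex, §6.3.4 Prop. 6.3.10] [cite: Lam2001FirstCourse, §21 Prop. (21.16)] -/
theorem corner_hodgeKunnethIdem_forall_isUnit_iff_of_add_eq (s t : ℕ) (hst : s + t = g + g) :
    (∀ x : (isIdempotentElem_hodgeKunnethIdem Φ e he e' s).Corner, x ≠ 0 → IsUnit x) ↔
      ∀ x : (isIdempotentElem_hodgeKunnethIdem Φ e he e' t).Corner, x ≠ 0 → IsUnit x :=
  corner_forall_isUnit_iff_of_ringEquiv_op _ _ (hodgeKunnethCornerDualEquiv Φ e he e' s t hst)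

/-- **The middle motive is self-dual: `End(hᵍ(X)) ≃+* End(hᵍ(X))ᵒᵖ`** — the corner of `π_g` in `B^g(X × X)` carries an
anti-automorphism (the transpose; `ᵗπ_g = π_g`). [cite: Lange2023AbelianVarietiesComplex, §6.3.4 Prop. 6.3.10] [cite: Kahn2020, §6.1] -/
def hodgeKunnethMiddleCornerOp :
    (isIdempotentElem_hodgeKunnethIdem Φ e he e' g).Corner ≃+* ((isIdempotentElem_hodgeKunnethIdem Φ e he e' g).Corner)ᵐᵒᵖ :=
  hodgeKunnethCornerDualEquiv Φ e he e' g g rfl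

section Lefschetz

variable [FiniteDimensional ℂ E] {η : E [⋀^Fin 2]→L[ℝ] ℝ}

/-- `π_s` is idempotent in `D^g(X × X)` (polarised torus; Milne's Cor. 5.8: the Künneth projectors are Lefschetz).
[cite: Milne1999LefschetzClasses, §5 Cor. 5.8] [cite: Lange2023AbelianVarietiesComplex, §6.3.4 Prop. 6.3.9 (a)] -/
theorem isIdempotentElem_lefschetzKunnethIdem (hη : IsRiemannForm Φ η) (s : ℕ) :
    IsIdempotentElem (⟨kunnethIdem Φ e he e' s, kunnethIdem_mem_lefschetzCorr Φ e he e' hη s⟩ : lefschetzCorr Φ e he e' hη) :=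
  Subtype.ext (isIdempotentElem_kunnethIdem Φ e he e' s).eq

/-- **Duality of Milne's Lefschetz motives: `End(hᵗ_Lef(X)) = π_t ∘ D^g(X × X) ∘ π_t ≃+* (π_s ∘ D^g(X × X) ∘ π_s)ᵒᵖ`,
`s + t = 2g`** (polarised torus). [cite: Milne1999LefschetzClasses, §5 Cor. 5.8] [cite: Lange2023AbelianVarietiesComplex, §6.3.4 Prop. 6.3.10] -/
def lefschetzKunnethCornerDualEquiv (hη : IsRiemannForm Φ η) (s t : ℕ) (hst : s + t = g + g) :
    (isIdempotentElem_lefschetzKunnethIdem Φ e he e' hη s).Corner ≃+*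
      ((isIdempotentElem_lefschetzKunnethIdem Φ e he e' hη t).Corner)ᵐᵒᵖ :=
  cornerTransposeEquivSub Φ e he e' _ (fun _ ha ↦ transpose_mem_lefschetzCorr Φ e he e' hη ha) _ _
    (by
      change transpose Φ e he e' (kunnethIdem Φ e he e' s) = kunnethIdem Φ e he e' t
      rw [transpose_kunnethIdem Φ e he e' s t hst])

end Lefschetz

/-! ## §4 The covariant realisation `End_ℚ(X) ≃+* End(h^{2g-1}(X))`, `B ↦ ᵗ(h¹(B))` -/

section Covariant

/-- **`hTopRatCornerEquiv : End_ℚ(X) ≃+* π_{2g-1} ∘ B^g(X × X) ∘ π_{2g-1} = End(h^{2g-1}(X))`, `B ↦ ᵗ(h¹(B))`** — a RING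
ISOMORPHISM (covariant: `ᵗh¹(CB) = ᵗh¹(C) ∘ ᵗh¹(B)`, g17-#7's `transpose_hOneRat_mul`), obtained as
`End_ℚ(X) = (End_ℚ(X)ᵒᵖ)ᵒᵖ ≅ End(h¹(X))ᵒᵖ ≅ End(h^{2g-1}(X))` from g18-#4's `hOneRatCornerEquiv` (Kahn Thm. 6.37) and §3
(`s = 1`, `t = 2g - 1`): the motive `h^{2g-1}(X) ≅ h¹(X)^∨(1-g) = h₁(X)(1-g)` realises `End_ℚ(X)` COVARIANTLY (Deligne–Milne's
`h₁`; g17-#7 described the image `{ᵗh¹(B)} = π_{2g-1} ∘ B^g` as a set). [cite: Kahn2020, §6.11 Thm. 6.37 and §6.1]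
[cite: DeligneMilne1982Tannakian, §6 Prop. 6.21 (a)] [cite: Lange2023AbelianVarietiesComplex, §6.3.4 Prop. 6.3.10] -/
def hTopRatCornerEquiv (h1 : 1 ≤ g + g) :
    endAlgRat Φ ≃+* (isIdempotentElem_hodgeKunnethIdem Φ e he e' (g + g - 1)).Corner :=
  RingEquiv.unop ((hOneRatCornerEquiv Φ e he e' h1).trans
    (hodgeKunnethCornerDualEquiv Φ e he e' 1 (g + g - 1) (Nat.add_sub_of_le h1)))

/-- **The underlying correspondence of `hTopRatCornerEquiv B` is `ᵗ(h¹(B))`** (g17-#3's `hOneRat` at `op B`, transposed).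
[cite: Kahn2020, §6.11 Thm. 6.37] [cite: Lange2023AbelianVarietiesComplex, §6.3.4 Prop. 6.3.10] -/
theorem coe_hTopRatCornerEquiv_apply (h1 : 1 ≤ g + g) (B : endAlgRat Φ) :
    (((hTopRatCornerEquiv Φ e he e' h1 B).1 : hodgeCorr Φ e he e') : CorrRing Φ e he e') =
      transpose Φ e he e' (hOneRat Φ e he e' h1 (op B) : CorrRing Φ e he e') := by
  change ((((hodgeKunnethCornerDualEquiv Φ e he e' 1 (g + g - 1) (Nat.add_sub_of_le h1)
      (hOneRatCornerEquiv Φ e he e' h1 (op B))).unop).1 : hodgeCorr Φ e he e') : CorrRing Φ e he e') = _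
  rw [coe_coe_unop_hodgeKunnethCornerDualEquiv_apply, coe_hOneRatCornerEquiv_apply]

/-- On integral endomorphisms: **`hTopRatCornerEquiv (α ⊗ 1) = π_{2g-1} ∘ [Γ_α]`** (g17-#7's
`transpose_coe_hOneRat_map_intCast`). [cite: Kahn2020, §6.11 Thm. 6.37] [cite: Lange2023AbelianVarietiesComplex, §6.3.4 Prop. 6.3.10] -/
theorem coe_hTopRatCornerEquiv_map_intCast (h1 : 1 ≤ g + g) (A : endRingInt Φ) :
    (((hTopRatCornerEquiv Φ e he e' h1 ⟨(A : Matrix ι ι ℤ).map (Int.cast : ℤ → ℚ), (mem_endRingInt_iff Φ).1 A.2⟩).1 :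
        hodgeCorr Φ e he e') : CorrRing Φ e he e') =
      kunnethIdem Φ e he e' (g + g - 1) * graphCorr Φ e he e' A := by
  rw [coe_hTopRatCornerEquiv_apply, transpose_coe_hOneRat_map_intCast]

/-- **`End(h^{2g-1}(X))` is semisimple iff `End_ℚ(X)` is** (any torus, `g ≥ 1`) — compare g22-#1 FILE 2's
`isSemisimpleRing_corner_hodgeKunnethIdem_one_iff` for `h¹`; here no `ᵒᵖ` intervenes. [cite: Kahn2020, §6.11 Thm. 6.37]
[cite: Lam2001FirstCourse, §21 Cor. (21.13)] -/
theorem isSemisimpleRing_corner_hodgeKunnethIdem_top_iff (h1 : 1 ≤ g + g) :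
    IsSemisimpleRing (isIdempotentElem_hodgeKunnethIdem Φ e he e' (g + g - 1)).Corner ↔ IsSemisimpleRing (endAlgRat Φ) :=
  (hTopRatCornerEquiv Φ e he e' h1).isSemisimpleRing_iff.symm

/-- **`End(h^{2g-1}(X))` is commutative iff `End_ℚ(X)` is.** [cite: Kahn2020, §6.11 Thm. 6.37] [cite: DeligneMilne1982Tannakian, §6 Prop. 6.21 (a)] -/
theorem corner_hodgeKunnethIdem_top_comm_iff (h1 : 1 ≤ g + g) :
    (∀ x y : (isIdempotentElem_hodgeKunnethIdem Φ e he e' (g + g - 1)).Corner, x * y = y * x) ↔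
      ∀ B C : endAlgRat Φ, B * C = C * B := by
  constructor
  · intro h B C
    apply (hTopRatCornerEquiv Φ e he e' h1).injective
    rw [map_mul, map_mul, h]
  · intro h x y
    apply (hTopRatCornerEquiv Φ e he e' h1).symm.injective
    rw [map_mul, map_mul, h]

end Covariant

end Transpose

end CorrRing

end ComplexTorus

end Literature.Geometry.Kaehler

end
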